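/-
Origin: expansion seat `prover-pub-hodgecm-mc-binder-1-g14-0`, handover #R92 2026-08-20T17:35:06Z md5 590c54464545 (179 l.; NEW additive universe-free leaf; imports Vendored UnitaryBallClassMap + UnitaryBallHolomorphicTranslate only; drop-alone; NAME LIST: HodgeCM.BallFormsTransfer.transfer_mem_factorForms · HodgeCM.BallFormsTransfer.toGroupFun_transfer · HodgeCM.BallFormsTransfer.transfer_mem_holFactorForms) (`HOME/mc/pub-hodgecm-mc-binder-1-g14/stage57/HodgeCM/Model/BallFormsTransfer.lean`, md5 590c54464545, 179 lines);
landed by the gen-23 packager (p-g23) in gate run 57 as `HodgeCM/Model/BallFormsTransfer.lean` (verbatim).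
-/
/-
Copyright (c) 2026 the pub-hodgecm formalisation cell (harness21).  New file, not vendored.
Origin: session prover-pub-hodgecm-mc-binder-1-g14-0 (unit pub-hodgecm-mc-binder-1-g14, BINDER PROVER gen 14 of lineage mc-binder-1;
content lane (J-Liu-Θ), scope memo `HOME/mc/pub-hodgecm-mc-binder-1-g14/JLIU-THETA-SCOPE.md` §9 (J2), ingredient (α3)/(β) «transfer = averaging on
invariant sections»), 2026-08-20.  Intended final place: `HodgeCM/Model/BallFormsTransfer.lean` (NEW additive leaf, universe-free; imports ONLY the vendored
twins `…ShimuraVarieties.UnitaryBallClassMap` and `…ShimuraVarieties.UnitaryBallHolomorphicTranslate`; nothing imports it; drop alone on bounce).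
-/
import Literature.AlgebraicGeometry.ShimuraVarieties.UnitaryBallClassMap
import Literature.AlgebraicGeometry.ShimuraVarieties.UnitaryBallHolomorphicTranslate

set_option autoImplicit false

/-!
# The transfer (trace) of sections of an automorphy factor from a finite-index subgroup — (J2) ingredient «transfer = averaging»

KERNEL lemmas over the vendored `BallForms.factorPullback` / `factorForms` vocabulary ([Borel1997 §5.13–5.14] as vendored in `UnitaryBallClassMap`);
nothing cited anew, nothing minted.  For a pull-back cocycle `A : G → Y → End V`, subgroups `N ≤ Γ ≤ G` with `Γ/N` finite (`Fintype (Γ ⧸ N.subgroupOf Γ)`,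
e.g. `Subgroup.fintypeQuotientOfFiniteIndex`):
* `transfer A Γ N F := Σ_{γN ∈ Γ/N} (γ⁻¹)^* F` (well defined on cosets for `N`-forms: `transferTerm_mk`, right-coset invariance `factorPullback_mul_of_mem`);
* `transfer_mem_factorForms` — the transfer of an `N`-form is a `Γ`-form; `transfer_of_mem` — on a `Γ`-form it is `[Γ:N] • F`;
* `toGroupFun_transfer` — on the group, `u_{Tr F}(g) = Σ_{γN} u_F(γ⁻¹ g)` (sum of LEFT translates: the shape of `π^* ∘ T_g` in the vendored
  `levelProj_map_heckeCorrespondenceAction`, read on sections instead of singular cochains); `transfer_add/_smul`;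
* on `𝔹²` with the cotangent cocycle: `factorPullback_mem_holomorphic` (chain rule, vendored `translate_mem_holomorphic`) and
  `transfer_mem_holFactorForms` — the transfer of a holomorphic `N`-form is a holomorphic `Γ`-form.
This is the section-level half of «Hecke operator = sum of translates on holomorphic one-forms» ((J2), memo §9); the cohomological half (de Rham naturality for
the level covers) is the HECKE-TOWER node's.  0 proof holes, 0 `axiom`; expected `#print axioms` ⊆ {propext, Classical.choice, Quot.sound}.
-/

noncomputable section

open Literature.AlgebraicGeometry.ShimuraVarieties
open Literature.AlgebraicGeometry.ShimuraVarieties.BallForms (factorPullback factorPullback_apply factorPullback_mul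
  factorPullback_one mem_factorForms_iff_factorPullback_eq)
open Literature.NumberTheory.Automorphic.AutomorphyFactor

namespace HodgeCM

namespace BallFormsTransfer

variable {G Y R V : Type*} [Group G] [MulAction G Y] [CommRing R] [AddCommGroup V] [Module R V]
variable {A : G → Y → Module.End R V}

/-- `γ^*` is additive. [folklore] -/
theorem factorPullback_add (γ : G) (F F' : Y → V) :
    factorPullback A γ (F + F') = factorPullback A γ F + factorPullback A γ F' := by
  funext x; simp [factorPullback_apply]

/-- `γ^* 0 = 0`. [folklore] -/
theorem factorPullback_zero (γ : G) : factorPullback A γ (0 : Y → V) = 0 := by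
  funext x; simp [factorPullback_apply]

/-- `γ^*` commutes with finite sums. [folklore] -/
theorem factorPullback_sum {ι : Type*} (s : Finset ι) (γ : G) (F : ι → Y → V) :
    factorPullback A γ (∑ i ∈ s, F i) = ∑ i ∈ s, factorPullback A γ (F i) := by
  classical
  induction s using Finset.induction_on with
  | empty => simp [factorPullback_zero]
  | insert i s hi ih => rw [Finset.sum_insert hi, Finset.sum_insert hi, factorPullback_add, ih]

/-- `γ^*` is homogeneous. [folklore] -/
theorem factorPullback_smul (γ : G) (r : R) (F : Y → V) :
    factorPullback A γ (r • F) = r • factorPullback A γ F := by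
  funext x; simp [factorPullback_apply]

/-- Right-coset invariance: for an `N`-form `F`, `(n γ)^* F = γ^* F`. [folklore] -/
theorem factorPullback_mul_of_mem (hA : IsPullbackCocycle A) {N : Subgroup G} {F : Y → V}
    (hF : F ∈ factorForms N A) {n : G} (hn : n ∈ N) (γ : G) :
    factorPullback A (n * γ) F = factorPullback A γ F := by
  rw [factorPullback_mul hA, (mem_factorForms_iff_factorPullback_eq.mp hF) n hn]

/-- The term of the transfer sum attached to a LEFT coset `q = γN` of `N` in `Γ`: `(γ⁻¹)^* F` — independent of the representative when
`F` is an `N`-form (`transferTerm_mk`). [folklore] -/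
def transferTerm (Γ N : Subgroup G) (F : Y → V) (q : Γ ⧸ N.subgroupOf Γ) : Y → V :=
  factorPullback A ((Quotient.out q : Γ) : G)⁻¹ F

/-- Independence of the representative. [folklore] -/
theorem transferTerm_mk (hA : IsPullbackCocycle A) {Γ N : Subgroup G} {F : Y → V} (hF : F ∈ factorForms N A) (γ : Γ) :
    transferTerm (A := A) Γ N F (γ : Γ ⧸ N.subgroupOf Γ) = factorPullback A (γ : G)⁻¹ F := by
  unfold transferTerm
  -- `out (mk γ) = γ * n` with `n ∈ N`, so `(out)⁻¹ = n⁻¹ γ⁻¹` and right-coset invariance applies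
  have h : ((Quotient.out (γ : Γ ⧸ N.subgroupOf Γ) : Γ))⁻¹ * γ ∈ N.subgroupOf Γ :=
    QuotientGroup.leftRel_apply.mp (Quotient.mk_out (s := QuotientGroup.leftRel (N.subgroupOf Γ)) γ)
  have hn : (((Quotient.out (γ : Γ ⧸ N.subgroupOf Γ) : Γ) : G))⁻¹ * (γ : G) ∈ N := by
    simpa [Subgroup.mem_subgroupOf] using h
  have : (((Quotient.out (γ : Γ ⧸ N.subgroupOf Γ) : Γ) : G))⁻¹ =
      ((((Quotient.out (γ : Γ ⧸ N.subgroupOf Γ) : Γ) : G))⁻¹ * (γ : G)) * (γ : G)⁻¹ := by group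
  rw [this, factorPullback_mul_of_mem hA hF hn]

variable (A) in
/-- **The transfer (trace) of an `N`-form to `Γ`** for a subgroup `N` of finite index in `Γ` (`Fintype (Γ ⧸ N.subgroupOf Γ)`, e.g.
`Subgroup.fintypeQuotientOfFiniteIndex`): `Tr F := Σ_{γN ∈ Γ/N} (γ⁻¹)^* F`. [cite: Borel1997, §5.13] -/
def transfer (Γ N : Subgroup G) [Fintype (Γ ⧸ N.subgroupOf Γ)] (F : Y → V) : Y → V :=
  ∑ q : Γ ⧸ N.subgroupOf Γ, transferTerm (A := A) Γ N F q

/-- **The transfer of an `N`-form is a `Γ`-form.** [folklore] -/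
theorem transfer_mem_factorForms (hA : IsPullbackCocycle A) {Γ N : Subgroup G} [Fintype (Γ ⧸ N.subgroupOf Γ)]
    {F : Y → V} (hF : F ∈ factorForms N A) : transfer A Γ N F ∈ factorForms Γ A := by
  rw [mem_factorForms_iff_factorPullback_eq]
  intro δ hδ
  unfold transfer
  rw [factorPullback_sum]
  -- reindex the sum by `q ↦ δ⁻¹ • q`
  refine Fintype.sum_equiv (MulAction.toPerm (⟨δ, hδ⟩⁻¹ : Γ)) _ _ fun q => ?_
  induction q using QuotientGroup.induction_on with
  | H γ =>
    rw [MulAction.toPerm_apply, MulAction.Quotient.smul_coe, transferTerm_mk hA hF, transferTerm_mk hA hF,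
      ← factorPullback_mul hA]
    congr 1
    simp [mul_inv_rev]

/-- On a `Γ`-form the transfer is multiplication by the index. [folklore] -/
theorem transfer_of_mem {Γ N : Subgroup G} [Fintype (Γ ⧸ N.subgroupOf Γ)]
    {F : Y → V} (hF : F ∈ factorForms Γ A) : transfer A Γ N F = ((N.subgroupOf Γ).index : R) • F := by
  unfold transfer
  have hterm : ∀ q : Γ ⧸ N.subgroupOf Γ, transferTerm (A := A) Γ N F q = F := fun q => by
    unfold transferTerm
    exact (mem_factorForms_iff_factorPullback_eq.mp hF) _ (Γ.inv_mem (Quotient.out q).2)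
  simp only [hterm, Finset.sum_const, Finset.card_univ]
  rw [← Nat.cast_smul_eq_nsmul R, Subgroup.index_eq_card, Nat.card_eq_fintype_card]

/-- **The group function of the transfer is the sum of LEFT translates**: `u_{Tr F}(g) = Σ_{γN ∈ Γ/N} u_F(γ⁻¹ g)` — the classical shape
of the cohomological transfer followed by pull-back (`levelProj_map_heckeCorrespondenceAction` on the topological side). [folklore] -/
theorem toGroupFun_transfer (hA : IsPullbackCocycle A) (o : Y) {Γ N : Subgroup G} [Fintype (Γ ⧸ N.subgroupOf Γ)]
    (F : Y → V) (g : G) :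
    toGroupFun A o (transfer A Γ N F) g =
      ∑ q : Γ ⧸ N.subgroupOf Γ, toGroupFun A o F ((((Quotient.out q : Γ) : G))⁻¹ * g) := by
  unfold transfer transferTerm
  simp only [toGroupFun_apply, Finset.sum_apply, map_sum]
  refine Finset.sum_congr rfl fun q _ => ?_
  have := BallForms.toGroupFun_mul_left hA o F ((((Quotient.out q : Γ) : G))⁻¹) g
  rw [toGroupFun_apply, toGroupFun_apply] at this
  exact this.symm

/-- The transfer is additive. [folklore] -/
theorem transfer_add {Γ N : Subgroup G} [Fintype (Γ ⧸ N.subgroupOf Γ)] (F F' : Y → V) :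
    transfer A Γ N (F + F') = transfer A Γ N F + transfer A Γ N F' := by
  unfold transfer transferTerm
  rw [← Finset.sum_add_distrib]
  exact Finset.sum_congr rfl fun q _ => factorPullback_add _ _ _

/-- The transfer is homogeneous. [folklore] -/
theorem transfer_smul {Γ N : Subgroup G} [Fintype (Γ ⧸ N.subgroupOf Γ)] (r : R) (F : Y → V) :
    transfer A Γ N (r • F) = r • transfer A Γ N F := by
  unfold transfer transferTerm
  rw [Finset.smul_sum]
  exact Finset.sum_congr rfl fun q _ => factorPullback_smul _ _ _

end BallFormsTransfer

/-! ### On the ball: the transfer of a HOLOMORPHIC `N`-form is a holomorphic `Γ`-form -/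

namespace BallFormsTransfer

open Literature.Geometry.ComplexHyperbolic.BallModel (U21 Ball Jac)
open Literature.AlgebraicGeometry.ShimuraVarieties.BallForms (cotangentCocycle isPullbackCocycle_cotangentCocycle holomorphic
  holFactorForms mem_holFactorForms_iff translate_mem_holomorphic factorPullback_cotangentCocycle_apply)

/-- For the cotangent cocycle on `𝔹²`, `γ^*` preserves holomorphy (chain rule, `translate_mem_holomorphic`). [folklore] -/
theorem factorPullback_mem_holomorphic (γ : U21) {F : Ball → (Fin 2 → ℂ)} (hF : F ∈ holomorphic (Fin 2 → ℂ)) :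
    factorPullback cotangentCocycle γ F ∈ holomorphic (Fin 2 → ℂ) := by
  have h := translate_mem_holomorphic γ hF
  convert h using 1
  funext z
  exact factorPullback_cotangentCocycle_apply γ F z

/-- **Transfer of holomorphic forms on the ball**: for `N ≤ Γ` of finite index, the transfer of a holomorphic `N`-form (weight = cotangent
cocycle, i.e. a holomorphic one-form on `N\𝔹²` pulled back to the ball) is a holomorphic `Γ`-form. -/
theorem transfer_mem_holFactorForms {Γ N : Subgroup U21} [Fintype (Γ ⧸ N.subgroupOf Γ)] {F : Ball → (Fin 2 → ℂ)}
    (hF : F ∈ holFactorForms N cotangentCocycle) : transfer cotangentCocycle Γ N F ∈ holFactorForms Γ cotangentCocycle := by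
  rw [mem_holFactorForms_iff] at hF ⊢
  refine ⟨transfer_mem_factorForms isPullbackCocycle_cotangentCocycle hF.1, ?_⟩
  unfold transfer transferTerm
  exact Submodule.sum_mem _ fun q _ => factorPullback_mem_holomorphic _ hF.2

end BallFormsTransfer

end HodgeCM

end
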